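/-
Copyright (c) 2026 the pub-hodgecm-mathlib formalisation cell (harness21).  Prover seat hodgecm-mathlib-LH4-p05 (g9), β CHAIR (LEDGER #20 handover from F0P3a-p01 (g37)), req620
Track A «(D-RAM) FOUR-FRAME» squad, helper lane on h413 = stmt-HodgeConjecture-24833 (count-neutral).  THE (β) PAY FILE: `cleanSgn_ofRecord` — the tier-0 letter
`stub_law_cleanSgn` (`Cruxes/H413/Lines/F0_P3c_DyRamFourFrame.lean` ED. 9 :211–212) PROVED BY NAME from ★ files only.  2026-09-04.
-/
import Summits.HodgeConjecture.HodgeConjecture.Theorems.F0P3cDyRamOddLabelledTubeRowsOfRecord             -- ★ p862243 (F0P3a-p01 (g37)): `hP3G1_ofRecord`, `hP3G2_ofRecord`, `hP2G3_ofRecord`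
import Summits.HodgeConjecture.HodgeConjecture.Theorems.F0P3cDyRamOddLabelledRestOfHeads                  -- ★ p862244 (F0P3a-p01 (g37)): `hRest_of_heads hK hW hB hZ`
import Summits.HodgeConjecture.HodgeConjecture.Theorems.F0P3cDyRamLabelledOddKappaClassG1Schema           -- ★ p862300 (LH4-p11 (g9)): `kappaSchema_G1` = schema `hK`
import Summits.HodgeConjecture.HodgeConjecture.Theorems.F0P3cDyRamLabelledOddCoreHangingEquilateralSchema -- ★ p862389 (LH7-p05 (g0)): `equilateralWindowSchema_H` = schema `hW` (over ★ p862295 EQ-2d + ★ p862340 EQ-3)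
import Summits.HodgeConjecture.HodgeConjecture.Theorems.F0P3cDyRamLabelledOddCoreHangingBoundarySchema    -- ★ p862354 (this seat): `boundarySchema_H` = schema `hB` (over ★ p862216, LH7-p08 (g0))
import Summits.HodgeConjecture.HodgeConjecture.Theorems.F0P3cDyRamLabelledOddCoreHangingShallowSum        -- ★ p862486 (LH4-p06 (g8)): `shallow₃_zero_schema` = schema `hZ` (R8 FILE 5d over LH7-p08's ★ 5a–5c, LH7-p07∕LH7-p06's ★ 5d′)
import Summits.HodgeConjecture.HodgeConjecture.Theorems.F0P3cDyRamOddLabelledBoxSum                       -- ★ p861510 (LH4-p08 (g10)): `oddLabelledBoxSum` (T3)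
import Summits.HodgeConjecture.HodgeConjecture.Theorems.F0P3cDyRamLabelledOddStageBTable                  -- ★ p861403 (F0P3a-p01): `hbox_of_oddBoxSum`; brings ★ p860646 BoxForm `…_of_box`
import HarnessLib

/-!
# Crux `H413`, line LH4 «(D-RAM) FOUR-FRAME» — STAGE 1b (β): THE CLEAN SIGN CENSUS IS FRAME-CONSTANT, OF RECORD — `cleanSgn_ofRecord`

Cell `hodgecm-mathlib` (D-0151), FLOOR 0, crux item H413 = `stmt-HodgeConjecture-24833`, route `HCCMUnconditional`; squad F0∕P3c∕LH4.  THEOREMS ONLY (no `def`, no instance, no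
notation, no `sorry`, default heartbeats); ★-only imports (NO `Lines` import); lane `--supports stmt-HodgeConjecture-24833 --as helper`.

WHAT THIS FILE DOES.  It proves, as ONE theorem whose TYPE is the tier-0 stub `F0P3cDyRamFourFrame.stub_law_cleanSgn`'s type VERBATIM (ED. 9 :211–212:
`∀ {K} … (σ ϖ d t), DyadicFence (CleanSgnFrameConstLawAt n0DerivedOfRecord mcOfRecord σ ϖ d t)`), the (β) law of STAGE 1b by the β-board PAY LINE of record (β chair
F0P3a-p01 (g37) LEDGER #19∕#20, kernel-checked by paste in `PAY-HARNESS` v1–v3 and by import in QA LH-ref2 (g13)'s T2 riders):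
`…StageBBoxForm.dyadicFence_cleanSgnFrameConstLawAt_derived_ofRecord_of_box (hbox_of_oddBoxSum oddLabelledBoxSum hP3G1_ofRecord hP3G2_ofRecord hP2G3_ofRecord (hRest_of_heads hK hW hB hZ))`
with the FOUR ∀-closed lattice schemas of ★ p862244 `hRest_of_heads` supplied BY NAME: `hK := kappaSchema_G1` (★ p862300, LH4-p11 (g9), tower-1 κ-class), `hW := equilateralWindowSchema_H`
(★ p862389, LH7-p05 (g0), equilateral window = EQ-2d strict window ⊔ EQ-3 locus), `hB := boundarySchema_H` (★ p862354, boundary H row, over LH7-p08 (g0)'s ★ p862216), `hZ := shallow₃_zero_schema`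
(★ p862486, LH4-p06 (g8), the shallow H zero, over LH7-p08's ★ 5a∕5b∕5b′∕5c and LH7-p07∕LH7-p06's ★ 5d′).  Upstream of those: the (T2) trunk ★ p861403 (odd table ⇒ box form ⇒ stub type,
★ p860646), the (T3) box identity ★ p861510, the three tube rows ★ p862243 and the `hRest` junction ★ p862244 over ★ p861938∕p861984∕p861953∕p862074∕p862171∕p862114∕p862207.
USE.  Pen LH4-plan (g14) cuts tier-0 ED. 10: `theorem stub_law_cleanSgn … := F0P3cDyRamCleanSgnOfRecord.cleanSgn_ofRecord` (statement bytes unchanged; heir LEAD T20-29 (b)).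
HONEST LABEL.  This file pays the (β) letter `stub_law_cleanSgn` BY NAME once ED. 10 is cut; it does NOT touch (β₂) `stub_law_cleanSgn₂`, so `stub_rows_transvPlus` ∕ T₊ and the organ
stay OPEN modulo β₂; h413 OPEN; `HC_CM` is proved only modulo the 7 printed citations (2 remaining named inputs: hLiu418 = `stmt-HodgeConjecture-24832`, h413 = `stmt-HodgeConjecture-24833`)
until rung 0 closes.

## References
* [Kottwitz1986BaseChangeUnits] R. E. Kottwitz, *Base change for unit elements of Hecke algebras*, Compositio Math. 60 (1986), §1 pp. 240–241 (signed lattice counts by strata).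
* [LanglandsShelstad1987] R. P. Langlands, D. Shelstad, *On the definition of transfer factors*, Math. Ann. 278 (1987), §3.
* [Rogawski1990] J. D. Rogawski, *Automorphic Representations of Unitary Groups in Three Variables*, Ann. of Math. Stud. 123 (1990), §4.9 Prop. 4.9.1 (a)(b) p. 55, §4.10 p. 58.
-/

set_option autoImplicit false

noncomputable section

namespace Summit.HodgeConjecture.HodgeConjecture.Cruxes.H413.F0P3cDyRamCleanSgnOfRecord

open Literature.NumberTheory.Automorphic Literature.NumberTheory.Automorphic.HermitianLattice Literature.NumberTheory.Automorphic.UnitaryGroup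
open Literature.NumberTheory.Automorphic.UnitaryLatticeTree Literature.NumberTheory.Automorphic.UnitaryThreeFourFrame
open Literature.NumberTheory.LocalFields Literature.NumberTheory.LocalFields.WildQuadraticDatum
open Summit.HodgeConjecture.HodgeConjecture.Cruxes.H413.F0P3cDyRamFourFrameLawDefs (DyadicFence)
open Summit.HodgeConjecture.HodgeConjecture.Cruxes.H413.F0P3cDyRamFourFramePieces
open Summit.HodgeConjecture.HodgeConjecture.Cruxes.H413.F0P3cDyRamFourFrameCensusDefs
open Summit.HodgeConjecture.HodgeConjecture.Cruxes.H413.F0P3cDyRamStageOneBDefs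
open Summit.HodgeConjecture.HodgeConjecture.Cruxes.H413.F0P3cDyRamStageOneBDerivedDefs
open Summit.HodgeConjecture.HodgeConjecture.Cruxes.H413.F0P3cDyRamDiagonalTorusDefs
open Summit.HodgeConjecture.HodgeConjecture.Cruxes.H413.F0P3cDyRamDiagonalStrataDefs
open Summit.HodgeConjecture.HodgeConjecture.Cruxes.H413.F0P3cDyRamLabelledOddCountDefs
open Summit.HodgeConjecture.HodgeConjecture.Cruxes.H413.F0P3cDyRamLabelledOddStageBBoxForm (dyadicFence_cleanSgnFrameConstLawAt_derived_ofRecord_of_box)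
open Summit.HodgeConjecture.HodgeConjecture.Cruxes.H413.F0P3cDyRamLabelledOddStageBTable (hbox_of_oddBoxSum)
open Summit.HodgeConjecture.HodgeConjecture.Cruxes.H413.F0P3cDyRamOddLabelledBoxSum (oddLabelledBoxSum)
open Summit.HodgeConjecture.HodgeConjecture.Cruxes.H413.F0P3cDyRamOddLabelledTubeRowsOfRecord (hP3G1_ofRecord hP3G2_ofRecord hP2G3_ofRecord)
open Summit.HodgeConjecture.HodgeConjecture.Cruxes.H413.F0P3cDyRamOddLabelledRestOfHeads (hRest_of_heads)
open Summit.HodgeConjecture.HodgeConjecture.Cruxes.H413.F0P3cDyRamLabelledOddKappaClassG1Schema (kappaSchema_G1)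
open Summit.HodgeConjecture.HodgeConjecture.Cruxes.H413.F0P3cDyRamLabelledOddCoreHangingEquilateralSchema (equilateralWindowSchema_H)
open Summit.HodgeConjecture.HodgeConjecture.Cruxes.H413.F0P3cDyRamLabelledOddCoreHangingBoundarySchema (boundarySchema_H)
open Summit.HodgeConjecture.HodgeConjecture.Cruxes.H413.F0P3cDyRamLabelledOddCoreHangingShallowSum (shallow₃_zero_schema)
open scoped Valued WithZero Matrix MatrixGroups

/-- **STAGE 1b (β) OF RECORD — THE CLEAN SIGN CENSUS IS FRAME-CONSTANT.**  For every complete discretely valued field `K` with finite residue field, every involution datum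
`(σ, ϖ, d, t)`: `DyadicFence (CleanSgnFrameConstLawAt n0DerivedOfRecord mcOfRecord σ ϖ d t)` — i.e. under the fence `|2| < 1`, the clean-shell signed census law (β) of
STAGE 1b at the derived regularity `n0DerivedOfRecord` and clean level `mcOfRecord`.  The TYPE is tier-0 `F0P3cDyRamFourFrame.stub_law_cleanSgn`'s type VERBATIM (ED. 9
:211–212); the proof is the β-board pay line: box form ★ p860646 `…_of_box` ∘ ★ p861403 `hbox_of_oddBoxSum` over the (T3) identity ★ p861510 `oddLabelledBoxSum`, the three
tube rows ★ p862243 and ★ p862244 `hRest_of_heads` at the four ★ lattice schemas `kappaSchema_G1` (κ₁), `equilateralWindowSchema_H` (EQW), `boundarySchema_H` (B₃),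
`shallow₃_zero_schema` (Z₃).  [cite: Kottwitz1986BaseChangeUnits, §1 pp. 240–241] [cite: LanglandsShelstad1987, §3] [cite: Rogawski1990, §4.9 Prop. 4.9.1 (a)(b) p. 55, §4.10 p. 58] -/
theorem cleanSgn_ofRecord :
    ∀ {K : Type} [Field K] [Valued K ℤᵐ⁰] [CompleteSpace K] [Fintype (Valued.ResidueField K)] (σ : K →+* K) (ϖ : K) (d t : ℕ),
    DyadicFence (K := K) (CleanSgnFrameConstLawAt n0DerivedOfRecord mcOfRecord σ ϖ d t) :=
  dyadicFence_cleanSgnFrameConstLawAt_derived_ofRecord_of_box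
    (hbox_of_oddBoxSum oddLabelledBoxSum hP3G1_ofRecord hP3G2_ofRecord hP2G3_ofRecord
      (hRest_of_heads kappaSchema_G1 equilateralWindowSchema_H boundarySchema_H shallow₃_zero_schema))

end Summit.HodgeConjecture.HodgeConjecture.Cruxes.H413.F0P3cDyRamCleanSgnOfRecord

end
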